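import Summits.Schanuel.Schanuel.Theorems.ZilberEacHyperellipticNorm
import HarnessLib

/-!
# Arbitrary base branches, XLIX (b): the cylinder `{x₁² = P(x₀), y₀ = A(x₀) + x₁B(x₀)}` is in
# Mantova–Masser's case

HONEST FRAMING.  Cell `pub-schanuel` (Zilber's Exponential-Algebraic Closedness, case ladder;
host summit Schanuel), seat 2, gen 30.  The case certificate for the general polynomial fibre over
a curve `C : x₁² = P(x₀)` (`P` with a simple root; any degree): **`mmCase_hyperelliptic_sheetFibre`**
— for `(A, B) ≠ (0, 0)` the surface `{x₁² − P(x₀) = 0, y₀ = A(x₀) + x₁B(x₀)}` is irreducible of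
dimension `2`, dominates `ℂ²_x` with one-dimensional projection data, meets the torus (the fibre
value has the nonzero norm `A² − PB²`, file XLIX), and `C` lies on no line (the involution
`x₁ ↦ −x₁`); **`mmCase_hyperelliptic_polyFibre`** — the same for `y₀ = R(x₀, x₁)` with `R` not
vanishing identically on `C` (reduction of file XLIX).  Case certificates only (no density claim
here); EC(3,2) OPEN; NOT Schanuel's conjecture; EAC ⇏ SC.
-/

noncomputable section

open Polynomial
open Literature.ModelTheory.Zilber

set_option linter.dupNamespace false

namespace Summit.Schanuel.Schanuel.Theorems

section HyperellipticCase

variable (P A B : ℂ[X])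

/-- **A point of the curve where the fibre value is nonzero** (`(A, B) ≠ (0, 0)`, `P` with a simple
root): at `x` with `(A² − PB²)(x) ≠ 0` and `z² = P(x)`, `A(x) + zB(x) ≠ 0`. [folklore] -/
theorem exists_sheetFibre_ne_zero (hAB : A ≠ 0 ∨ B ≠ 0) {r : ℂ} (hr : P.IsRoot r)
    (hr1 : P.derivative.eval r ≠ 0) :
    ∃ x z : ℂ, z ^ 2 = P.eval x ∧ A.eval x + z * B.eval x ≠ 0 := by
  have hN : A ^ 2 - P * B ^ 2 ≠ 0 := sq_sub_mul_sq_ne_zero P A B hr hr1 hAB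
  obtain ⟨x, hx⟩ : ∃ x, (A ^ 2 - P * B ^ 2).eval x ≠ 0 := by
    by_contra hall
    push Not at hall
    exact hN (Polynomial.funext (by simpa using hall))
  obtain ⟨z, hz⟩ := IsAlgClosed.exists_pow_nat_eq (P.eval x) two_pos
  refine ⟨x, z, hz, fun h0 => hx ?_⟩
  rw [← sheet_mul_sheet_eq P A B hz, h0, zero_mul]

/-- **The curve `x₁² = P(x₀)` lies on no line** (`P ≠ 0`): for every nonzero `m ∈ ℤ²` and `c₀`
some point has `m₀x₀ + m₁x₁ ≠ c₀` (the involution `x₁ ↦ −x₁` would force `P ≡ 0`). [folklore] -/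
theorem hyperelliptic_exists_offLine (hP0 : P ≠ 0) (m : Fin 2 → ℤ) (hm : m ≠ 0) (c₀ : ℂ) :
    ∃ x : Fin 2 → ℂ, MvPolynomial.eval x
        (MvPolynomial.X 1 ^ 2 - Polynomial.aeval (MvPolynomial.X 0 : MvPolynomial (Fin 2) ℂ) P) = 0 ∧
      (m 0 : ℂ) * x 0 + (m 1 : ℂ) * x 1 ≠ c₀ := by
  by_contra hall
  push Not at hall
  have hpt : ∀ x y : ℂ, y ^ 2 = P.eval x → (m 0 : ℂ) * x + (m 1 : ℂ) * y = c₀ := by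
    intro x y hy
    have := hall ![x, y] (by rw [eval_superellipticMv]; simp [hy])
    simpa using this
  by_cases hm1 : (m 1 : ℂ) = 0
  · have hm0 : (m 0 : ℂ) ≠ 0 := by
      intro h0
      apply hm
      funext i
      fin_cases i
      · exact_mod_cast h0
      · exact_mod_cast hm1
    obtain ⟨y₀, hy₀⟩ := IsAlgClosed.exists_pow_nat_eq (P.eval 0) two_pos
    obtain ⟨y₁, hy₁⟩ := IsAlgClosed.exists_pow_nat_eq (P.eval 1) two_pos
    have h0 := hpt 0 y₀ hy₀
    have h1 := hpt 1 y₁ hy₁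
    rw [hm1] at h0 h1
    apply hm0
    linear_combination h1 - h0
  · have hzero : ∀ x : ℂ, P.eval x = 0 := by
      intro x
      obtain ⟨y, hy⟩ := IsAlgClosed.exists_pow_nat_eq (P.eval x) two_pos
      have hy1 := hpt x y hy
      have hy2 := hpt x (-y) (by rw [neg_sq]; exact hy)
      have hy0 : y = 0 := by
        have h2 : (m 1 : ℂ) * (2 * y) = 0 := by linear_combination hy1 - hy2
        have h3 := (mul_eq_zero.1 h2).resolve_left hm1
        exact (mul_eq_zero.1 h3).resolve_left two_ne_zero
      rw [← hy, hy0, zero_pow two_ne_zero]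
    exact hP0 (Polynomial.funext (by simpa using hzero))

/-- **The cylinder `{x₁² − P(x₀) = 0, y₀ = A(x₀) + x₁B(x₀)}` is in Mantova–Masser's case**
(`P` with a simple root, `(A, B) ≠ (0, 0)`). (new) -/
theorem mmCase_hyperelliptic_sheetFibre (hAB : A ≠ 0 ∨ B ≠ 0) {r : ℂ} (hr : P.IsRoot r)
    (hr1 : P.derivative.eval r ≠ 0) :
    MMCaseDimPiOneFree {w : Fin 2 ⊕ Fin 2 → ℂ |
      MvPolynomial.eval ![w (Sum.inl 0), w (Sum.inl 1)]
          (MvPolynomial.X 1 ^ 2 - Polynomial.aeval (MvPolynomial.X 0 : MvPolynomial (Fin 2) ℂ) P) = 0 ∧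
      w (Sum.inr 0) = MvPolynomial.eval ![w (Sum.inl 0), w (Sum.inl 1)]
        (Polynomial.aeval (MvPolynomial.X 0 : MvPolynomial (Fin 2) ℂ) A +
          MvPolynomial.X 1 * Polynomial.aeval (MvPolynomial.X 0 : MvPolynomial (Fin 2) ℂ) B)} := by
  have hP0 : P ≠ 0 := by
    rintro rfl
    simp at hr1
  refine mmCase_curveGraphFibre (irreducible_superellipticMv P (by norm_num : 1 ≤ 2) hr hr1) ?_
    (hyperelliptic_exists_offLine P hP0)
  obtain ⟨x, z, hz, hne⟩ := exists_sheetFibre_ne_zero P A B hAB hr hr1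
  refine ⟨![x, z], by rw [eval_superellipticMv]; simp [hz], ?_⟩
  rw [eval_sheetFibreMv]
  simpa using hne

/-- **A polynomial not vanishing identically on the curve has a nonzero reduction.** [folklore] -/
theorem reduction_ne_zero (R Q : MvPolynomial (Fin 2) ℂ)
    (hRAB : R = Polynomial.aeval (MvPolynomial.X 0 : MvPolynomial (Fin 2) ℂ) A +
        MvPolynomial.X 1 * Polynomial.aeval (MvPolynomial.X 0 : MvPolynomial (Fin 2) ℂ) B +
        (MvPolynomial.X 1 ^ 2 - Polynomial.aeval (MvPolynomial.X 0 : MvPolynomial (Fin 2) ℂ) P) * Q)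
    (hR : ∃ x : Fin 2 → ℂ, MvPolynomial.eval x
        (MvPolynomial.X 1 ^ 2 - Polynomial.aeval (MvPolynomial.X 0 : MvPolynomial (Fin 2) ℂ) P) = 0 ∧
      MvPolynomial.eval x R ≠ 0) :
    A ≠ 0 ∨ B ≠ 0 := by
  by_contra h
  push Not at h
  obtain ⟨hA, hB⟩ := h
  obtain ⟨x, hx1, hx2⟩ := hR
  apply hx2
  rw [hRAB, hA, hB, map_add, map_add, map_mul, map_mul, hx1]
  simp

/-- **The cylinder `{x₁² − P(x₀) = 0, y₀ = R(x₀, x₁)}` is in Mantova–Masser's case** for every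
`R` not vanishing identically on the curve (`P` with a simple root). (new) -/
theorem mmCase_hyperelliptic_polyFibre (R : MvPolynomial (Fin 2) ℂ)
    (hR : ∃ x : Fin 2 → ℂ, MvPolynomial.eval x
        (MvPolynomial.X 1 ^ 2 - Polynomial.aeval (MvPolynomial.X 0 : MvPolynomial (Fin 2) ℂ) P) = 0 ∧
      MvPolynomial.eval x R ≠ 0)
    {r : ℂ} (hr : P.IsRoot r) (hr1 : P.derivative.eval r ≠ 0) :
    MMCaseDimPiOneFree {w : Fin 2 ⊕ Fin 2 → ℂ |
      MvPolynomial.eval ![w (Sum.inl 0), w (Sum.inl 1)]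
          (MvPolynomial.X 1 ^ 2 - Polynomial.aeval (MvPolynomial.X 0 : MvPolynomial (Fin 2) ℂ) P) = 0 ∧
      w (Sum.inr 0) = MvPolynomial.eval ![w (Sum.inl 0), w (Sum.inl 1)] R} := by
  obtain ⟨A', B', Q, hRAB⟩ := exists_hyperelliptic_reduction P R
  rw [curveGraphFibre_eq_of_reduction P A' B' R Q hRAB]
  exact mmCase_hyperelliptic_sheetFibre P A' B' (reduction_ne_zero P A' B' R Q hRAB hR) hr hr1

/-- The cylinder in plain coordinates. -/
theorem sheetFibre_setOf_eq :
    {w : Fin 2 ⊕ Fin 2 → ℂ |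
        MvPolynomial.eval ![w (Sum.inl 0), w (Sum.inl 1)]
            (MvPolynomial.X 1 ^ 2 - Polynomial.aeval (MvPolynomial.X 0 : MvPolynomial (Fin 2) ℂ) P) = 0 ∧
        w (Sum.inr 0) = MvPolynomial.eval ![w (Sum.inl 0), w (Sum.inl 1)]
          (Polynomial.aeval (MvPolynomial.X 0 : MvPolynomial (Fin 2) ℂ) A +
            MvPolynomial.X 1 * Polynomial.aeval (MvPolynomial.X 0 : MvPolynomial (Fin 2) ℂ) B)} =
      {w : Fin 2 ⊕ Fin 2 → ℂ |
        w (Sum.inl 1) ^ 2 - P.eval (w (Sum.inl 0)) = 0 ∧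
        w (Sum.inr 0) = A.eval (w (Sum.inl 0)) + w (Sum.inl 1) * B.eval (w (Sum.inl 0))} := by
  ext w
  simp only [Set.mem_setOf_eq, eval_superellipticMv, eval_sheetFibreMv, Matrix.cons_val_zero,
    Matrix.cons_val_one]

/-- **Plain coordinates**: `{x₁² − P(x₀) = 0, y₀ = A(x₀) + x₁B(x₀)}` is in Mantova–Masser's case
(`P` with a simple root, `(A, B) ≠ (0, 0)`). (new) -/
theorem mmCase_hyperelliptic_sheetFibre' (hAB : A ≠ 0 ∨ B ≠ 0) {r : ℂ} (hr : P.IsRoot r)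
    (hr1 : P.derivative.eval r ≠ 0) :
    MMCaseDimPiOneFree {w : Fin 2 ⊕ Fin 2 → ℂ |
      w (Sum.inl 1) ^ 2 - P.eval (w (Sum.inl 0)) = 0 ∧
      w (Sum.inr 0) = A.eval (w (Sum.inl 0)) + w (Sum.inl 1) * B.eval (w (Sum.inl 0))} := by
  rw [← sheetFibre_setOf_eq]
  exact mmCase_hyperelliptic_sheetFibre P A B hAB hr hr1

end HyperellipticCase

end Summit.Schanuel.Schanuel.Theorems

end
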